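import Mathlib
import Summits.Ventures.PercRepro.TriangleCapFiveRowFourCapB2
import Summits.Ventures.PercRepro.TriangleCapFiveRowFourB2Pieces
import Summits.Ventures.PercRepro.TriangleCapFiveRowFour
import Summits.Ventures.PercRepro.TriangleCapFourRowThreeSecondBest
import Summits.Ventures.PercRepro.TriangleCapRowFourTFamilyTable

/-!
# PercRepro — THE ROW `a = 5` AT `r = 4` AT THE SHARP GAP: a `K₄⁻`-free graph with `5 (k − 5) − 4` edges on `k ≥ 14`
vertices is `5`-bipartite or at least `B2 = 2k − 22` below the closed form, and the family `B2`
(`K_{6,k−6}` minus a `(k − 7)`-star) attains it — the non-bipartite stability table extends to `(k, 5, 4)`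
(p3, gen 47; part 200c)

THE CORRECTION FIRST: the open item of gen 46 read "the sharp gap on `(k, 5, 4)` is `T = 2k − 14`" — that is the gap
of `tFamilyGen (k − 1) 5 2`, which lies on the cell `(k, 5, 5)` (`tFamilyGen_value`: the cell `(n + 1, a, r + a − 2)`).
The one-triangle family of `(k, 5, 4)` is `tFamilyGen (k − 1) 5 1`, `2k − 18` below, and it is NOT the second best: the
family `B2 = K_{6,k−6}` minus a `(k − 7)`-star (`bipMinusStar k 6 (k − 7)`, a bipartite graph whose only bipartition has
sides `6` and `k − 6`) lies `2k − 22` below, as the conjecture `min {B2, T}` of part 199 (`r = a − 1`) predicts.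

NO INDUCTION: a vertex at the cap `k − 5` is part 200a (`five_four_cap_B2`); if every degree lies in `[5, k − 6]` the
convexity of that window gives the target with slack `3k − 16` (`five_four_convex_B2`); otherwise a vertex `z` of
degree `d ≤ 4` is deleted onto the LANDED cells `(k − 1, 5, d − 1)` — `d = 0` the closed form on `(k − 1, 6, k − 13)`,
`d = 1` the diagonal (`K_{5,k−6}` plus a pendant vertex at the large side IS the family `B2`: exact), `d = 2` the cell
`(k − 1, 5, 1)`, `d = 3` the cell `(k − 1, 5, 2)`, `d = 4` the cell `(k − 1, 5, 3)` at its sharp gap `T = 2 (k − 1) − 22`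
(part 199m) — every neighbour of `z` at degree `≤ k − 7` in `D − z` because `D` has no vertex at the cap (this is
what the within-row induction of part 199x lacked: there the deleted vertex had degree `5` and its neighbours could
sit at the cap). `five_four_nonbip_second_best (14 ≤ k)`: the non-`5`-bipartite second-best value on `(k, 5, 4)` is
EXACTLY `m k − 4 (k − 5) − (2k − 22)`; `nonbip_second_best_row_five_T (r = 3 ∨ r = 4)`: in the vocabulary of
`tFamilyGap` (`tFamilyGap k 5 3 = tFamilyGap k 5 4 = 2 (k − 11)`). Axioms: standard.
-/

namespace PercRepro

namespace TriangleCap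

namespace C047

open Finset

variable {V : Type*} [Fintype V] [DecidableEq V]

/-- **THE ROW `a = 5` AT `r = 4` AT THE SHARP GAP `B2`:** `K₄⁻`-free, `m + 4 = 5 (k − 5)`, `14 ≤ k` ⇒ `D` is a
spanning subgraph of some `K(A, Aᶜ)` with `|A| = 5`, or `Σ_v d(v)² + 4 (k − 5) + (2k − 22) ≤ m k`. -/
theorem five_four_second_order_B2 (D : SimpleGraph V) [DecidableRel D.Adj] (hK : K4mFree D)
    (hk : 14 ≤ Fintype.card V) (hm : D.edgeFinset.card + 4 = 5 * (Fintype.card V - 5)) :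
    (∃ A : Finset V, A.card = 5 ∧ BipSub D A) ∨
      ∑ v, deg D v * deg D v + 4 * (Fintype.card V - 5) + (2 * Fintype.card V - 22) ≤
        D.edgeFinset.card * Fintype.card V := by
  -- (A) a vertex at the cap `k − 5`
  by_cases hx : ∃ x, deg D x + 5 = Fintype.card V
  · obtain ⟨x, hx⟩ := hx
    exact five_four_cap_B2 D hK hk hm x hx
  push Not at hx
  have hcap : ∀ v, deg D v + 5 ≤ Fintype.card V := fun v =>
    deg_add_le_card_of_dense D hK 5 (by norm_num) (by omega)
      (cap_arith 5 (Fintype.card V) D.edgeFinset.card 4 (by norm_num) (by omega) (by omega)) v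
  have hcap' : ∀ v, deg D v + 5 + 1 ≤ Fintype.card V := fun v => by
    have h1 := hcap v
    have h2 := hx v
    omega
  have hcap6 : ∀ v, deg D v + 6 ≤ Fintype.card V := fun v => by have := hcap' v; omega
  have hcap7 : ∀ v, deg D v ≤ (Fintype.card V - 7) + 1 := fun v => by have := hcap' v; omega
  -- (B) every degree `≥ 5`: the convexity of the window `[5, k − 6]`
  by_cases hdeg : ∀ v, 5 ≤ deg D v
  · exact Or.inr (five_four_convex_B2 D hk hm hcap6 hdeg)
  push Not at hdeg
  obtain ⟨z, hz⟩ := hdeg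
  -- the deletion bookkeeping
  have hK' := k4mFree_del D hK z
  have hcard' := card_del z
  have hedges' := card_edges_del D z
  have hsq := sum_deg_sq_del D z
  have hT := sum_del_nbhd_le D z (Fintype.card V - 7) hcap7
  have hNz := card_nbhd_del D z
  obtain ⟨T, hTdef⟩ : ∃ T, ∑ a : {v : V // v ≠ z}, (if D.Adj a.1 z then deg (del D z) a else 0) = T := ⟨_, rfl⟩
  obtain ⟨S', hS'def⟩ : ∃ S', ∑ a : {v : V // v ≠ z}, deg (del D z) a * deg (del D z) a = S' := ⟨_, rfl⟩
  obtain ⟨m', hm'def⟩ : ∃ m', (del D z).edgeFinset.card = m' := ⟨_, rfl⟩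
  rw [hTdef, hS'def] at hsq
  rw [hTdef] at hT
  rw [hm'def] at hedges'
  obtain ⟨s, hs⟩ : ∃ s, Fintype.card V = s + 14 := ⟨Fintype.card V - 14, by omega⟩
  have hcardV' : Fintype.card {v : V // v ≠ z} = s + 13 := by omega
  -- the side lemma for a `5`-bipartite `D − z`
  have hside : ∀ A' : Finset {v : V // v ≠ z}, A'.card = 5 → BipSub (del D z) A' →
      (∃ A : Finset V, A.card = 5 ∧ BipSub D A) ∨
        (∑ v, deg D v * deg D v + 4 * (Fintype.card V - 5) + (2 * Fintype.card V - 22) ≤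
          D.edgeFinset.card * Fintype.card V) ∨
        (T + (Fintype.card V - 7) ≤ deg D z * (Fintype.card V - 7) + 5) := by
    intro A' hA'card hB
    have := five_four_sides_B2 D hk hm z A' hA'card hB hcap7
    rw [hTdef] at this
    exact this
  have hd : deg D z = 0 ∨ deg D z = 1 ∨ deg D z = 2 ∨ deg D z = 3 ∨ deg D z = 4 := by omega
  rcases hd with hd0 | hd1 | hd2 | hd3 | hd4
  · -- `d = 0`: the closed form on `(k − 1, 6, k − 13)`
    right
    have hm'0 : m' = 5 * s + 41 := by omega
    have h := closed_form_stability (del D z) hK' 6 (s + 14 - 13) (by norm_num) (by rw [hcardV']; omega)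
      (by rw [hm'def, hcardV', hm'0]; omega)
    rw [hS'def, hm'def, hcardV'] at h
    have e : s + 13 - 1 - (s + 14 - 13) = 11 := by omega
    rw [e] at h
    rw [hd0, hs] at hT
    rw [hsq, ← hedges', hs, hd0]
    exact five_four_B2_del_zero s m' S' T hm'0 h hT
  · -- `d = 1`: the diagonal `(k − 1, 5, 0)` at second order
    have hm'1 : m' = 5 * s + 40 := by omega
    rcases diag_second_order_gen (del D z) hK' 5 (by norm_num) (by omega) (by rw [hm'def, hcardV', hm'1]; omega)
      with ⟨A', hA'card, hB⟩ | hgap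
    · rcases hside A' hA'card hB with h | h | hT'
      · exact Or.inl h
      · exact Or.inr h
      · -- the envelope closes exactly: this is the family `B2`
        right
        have henv := sum_deg_sq_le_of_k4mFree (del D z) hK' (by omega)
        rw [hS'def, hm'def, hcardV'] at henv
        rw [hs, hd1] at hT'
        rw [hsq, ← hedges', hs, hd1]
        exact five_four_B2_del_one_env s m' S' T hm'1 henv hT'
    · right
      rw [hS'def, hm'def, hcardV'] at hgap
      rw [hd1, hs] at hT
      rw [hsq, ← hedges', hs, hd1]
      exact five_four_B2_del_one_gap s m' S' T hm'1 hgap hT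
  · -- `d = 2`: the cell `(k − 1, 5, 1)`
    have hm'2 : m' = 5 * s + 39 := by omega
    rcases one_below_second_order_gen (del D z) hK' 5 (by norm_num) (by omega)
      (by rw [hm'def, hcardV', hm'2]; omega) with ⟨A', hA'card, hB⟩ | hgap
    · rcases hside A' hA'card hB with h | h | hT'
      · exact Or.inl h
      · exact Or.inr h
      · right
        have hS := sum_deg_sq_le_of_bipSub (del D z) A' hB 5 1 hA'card (by rw [hm'def, hcardV', hm'2]; omega)
          (by omega)
        rw [hS'def, hm'def, hcardV'] at hS
        rw [hs, hd2] at hT'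
        rw [hsq, ← hedges', hs, hd2]
        exact five_four_B2_del_two_mixed s m' S' T hm'2 hS hT'
    · right
      rw [hS'def, hm'def, hcardV'] at hgap
      rw [hd2, hs] at hT
      rw [hsq, ← hedges', hs, hd2]
      exact five_four_B2_del_two_gap s m' S' T hm'2 hgap hT
  · -- `d = 3`: the cell `(k − 1, 5, 2)`
    have hm'3 : m' = 5 * s + 38 := by omega
    rcases below_second_order_gen (del D z) hK' 5 2 (by norm_num) (by norm_num) (by norm_num) (by omega)
      (by rw [hm'def, hcardV', hm'3]; omega) with ⟨A', hA'card, hB⟩ | hgap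
    · rcases hside A' hA'card hB with h | h | hT'
      · exact Or.inl h
      · exact Or.inr h
      · right
        have hS := sum_deg_sq_le_of_bipSub (del D z) A' hB 5 2 hA'card (by rw [hm'def, hcardV', hm'3]; omega)
          (by omega)
        rw [hS'def, hm'def, hcardV'] at hS
        rw [hs, hd3] at hT'
        rw [hsq, ← hedges', hs, hd3]
        exact five_four_B2_del_three_mixed s m' S' T hm'3 hS hT'
    · right
      rw [hS'def, hm'def, hcardV'] at hgap
      rw [hd3, hs] at hT
      rw [hsq, ← hedges', hs, hd3]
      exact five_four_B2_del_three_gap s m' S' T hm'3 hgap hT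
  · -- `d = 4`: the cell `(k − 1, 5, 3)` at its sharp gap
    have hm'4 : m' = 5 * s + 37 := by omega
    rcases five_three_second_order (del D z) hK' (by omega) (by rw [hm'def, hcardV', hm'4]; omega)
      with ⟨A', hA'card, hB⟩ | hgap
    · rcases hside A' hA'card hB with h | h | hT'
      · exact Or.inl h
      · exact Or.inr h
      · right
        have hS := sum_deg_sq_le_of_bipSub (del D z) A' hB 5 3 hA'card (by rw [hm'def, hcardV', hm'4]; omega)
          (by omega)
        rw [hS'def, hm'def, hcardV'] at hS
        rw [hs, hd4] at hT'
        rw [hsq, ← hedges', hs, hd4]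
        exact five_four_B2_del_four_mixed s m' S' T hm'4 hS hT'
    · right
      rw [hS'def, hm'def, hcardV'] at hgap
      rw [hd4, hs] at hT
      rw [hsq, ← hedges', hs, hd4]
      exact five_four_B2_del_four_gap s m' S' T hm'4 hgap hT

/-- Six distinct vertices of degree `≥ 6` do not fit into the `5`-side of a spanning subgraph of `K(A, Aᶜ)`. -/
theorem not_bipSub_five_of_six (D : SimpleGraph V) [DecidableRel D.Adj] (v₁ v₂ v₃ v₄ v₅ v₆ : V)
    (h12 : v₁ ≠ v₂) (h13 : v₁ ≠ v₃) (h14 : v₁ ≠ v₄) (h15 : v₁ ≠ v₅) (h16 : v₁ ≠ v₆) (h23 : v₂ ≠ v₃)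
    (h24 : v₂ ≠ v₄) (h25 : v₂ ≠ v₅) (h26 : v₂ ≠ v₆) (h34 : v₃ ≠ v₄) (h35 : v₃ ≠ v₅) (h36 : v₃ ≠ v₆)
    (h45 : v₄ ≠ v₅) (h46 : v₄ ≠ v₆) (h56 : v₅ ≠ v₆)
    (hd1 : 6 ≤ deg D v₁) (hd2 : 6 ≤ deg D v₂) (hd3 : 6 ≤ deg D v₃) (hd4 : 6 ≤ deg D v₄) (hd5 : 6 ≤ deg D v₅)
    (hd6 : 6 ≤ deg D v₆) (A : Finset V) (hA : A.card = 5) : ¬ BipSub D A := by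
  intro hB
  have hin : ∀ v, 6 ≤ deg D v → v ∈ A := by
    intro v hv
    by_contra h
    have := deg_le_card_of_bipSub D A hB v h
    omega
  have hsub : ({v₁, v₂, v₃, v₄, v₅, v₆} : Finset V) ⊆ A := by
    intro v hv
    simp only [mem_insert, mem_singleton] at hv
    rcases hv with rfl | rfl | rfl | rfl | rfl | rfl
    · exact hin _ hd1
    · exact hin _ hd2
    · exact hin _ hd3
    · exact hin _ hd4
    · exact hin _ hd5
    · exact hin _ hd6
  have hcard : ({v₁, v₂, v₃, v₄, v₅, v₆} : Finset V).card = 6 := by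
    rw [card_insert_of_notMem, card_insert_of_notMem, card_insert_of_notMem, card_insert_of_notMem,
      card_insert_of_notMem, card_singleton]
    · simp [h56]
    · simp [h45, h46]
    · simp [h34, h35, h36]
    · simp [h23, h24, h25, h26]
    · simp [h12, h13, h14, h15, h16]
  have := card_le_card hsub
  omega

/-- The degrees of the witness `bipMinusStar k 6 (k − 7)`: `k − 6` at the vertices `1, …, 5` of the `6`-side. -/
theorem five_four_witness_deg_small (k : ℕ) (hk : 14 ≤ k) (i : ℕ) (hi1 : 1 ≤ i) (hi : i < 6) :
    deg (bipMinusStar k 6 (k - 7)) ⟨i, by omega⟩ = k - 6 := by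
  rw [deg_bipMinusStar k 6 (k - 7) (by norm_num) (by omega)]
  have h0 : (⟨i, by omega⟩ : Fin k).val ≠ 0 := by simp only; omega
  have hst : (⟨i, by omega⟩ : Fin k) ∉ rightStar k 6 (k - 7) := by
    rw [rightStar, mem_filter]
    simp only [mem_univ, true_and]
    omega
  rw [if_neg h0, if_neg hst]
  exact deg_bip_of_lt k 6 (by omega) _ (by simp only; omega)

/-- The degree of the witness `bipMinusStar k 6 (k − 7)` at its last vertex: `6`. -/
theorem five_four_witness_deg_last (k : ℕ) (hk : 14 ≤ k) :
    deg (bipMinusStar k 6 (k - 7)) ⟨k - 1, by omega⟩ = 6 := by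
  rw [deg_bipMinusStar k 6 (k - 7) (by norm_num) (by omega)]
  have h0 : (⟨k - 1, by omega⟩ : Fin k).val ≠ 0 := by simp only; omega
  have hst : (⟨k - 1, by omega⟩ : Fin k) ∉ rightStar k 6 (k - 7) := by
    rw [rightStar, mem_filter]
    simp only [mem_univ, true_and]
    omega
  rw [if_neg h0, if_neg hst]
  exact deg_bip_of_not_lt k 6 (by omega) _ (by simp only; omega)

/-- **THE WITNESS ON `(k, 5, 4)`:** `bipMinusStar k 6 (k − 7)` (`K_{6,k−6}` minus a `(k − 7)`-star, the family `B2`)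
is `K₄⁻`-free with `5 (k − 5) − 4` edges, is `5`-bipartite for no `A`, and has
`Σ_v d(v)² + 4 (k − 5) + (2k − 22) = m k` (`k ≥ 14`). -/
theorem five_four_witness (k : ℕ) (hk : 14 ≤ k) :
    K4mFree (bipMinusStar k 6 (k - 7)) ∧ (bipMinusStar k 6 (k - 7)).edgeFinset.card + 4 = 5 * (k - 5) ∧
      (¬ ∃ A : Finset (Fin k), A.card = 5 ∧ BipSub (bipMinusStar k 6 (k - 7)) A) ∧
      ∑ v, deg (bipMinusStar k 6 (k - 7)) v * deg (bipMinusStar k 6 (k - 7)) v + 4 * (k - 5) + (2 * k - 22) =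
        (bipMinusStar k 6 (k - 7)).edgeFinset.card * k := by
  have hE := card_edges_bipMinusStar k 6 (k - 7) (by norm_num) (by omega)
  have hS := (sums_bipMinusStar k 6 (k - 7) (by norm_num) (by omega)).2
  refine ⟨k4mFree_bipMinusStar k 6 (k - 7), ?_, ?_, ?_⟩
  · have e : 6 * (k - 6) = 5 * (k - 5) + (k - 11) := by omega
    omega
  · rintro ⟨A, hA, hB⟩
    have h6k : 6 ≤ k := by omega
    have hne : ∀ (i j : ℕ) (hi : i < 6) (hj : j < 6), i ≠ j →
        (⟨i, lt_of_lt_of_le hi h6k⟩ : Fin k) ≠ ⟨j, lt_of_lt_of_le hj h6k⟩ := by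
      intro i j _ _ hij h
      have := congrArg Fin.val h
      simp only at this
      exact hij this
    have hnel : ∀ (i : ℕ) (hi : i < 6), (⟨i, lt_of_lt_of_le hi h6k⟩ : Fin k) ≠ ⟨k - 1, by omega⟩ := by
      intro i _ h
      have := congrArg Fin.val h
      simp only at this
      omega
    have hd : ∀ (i : ℕ) (hi1 : 1 ≤ i) (hi : i < 6),
        6 ≤ deg (bipMinusStar k 6 (k - 7)) ⟨i, lt_of_lt_of_le hi h6k⟩ := by
      intro i hi1 hi
      rw [five_four_witness_deg_small k hk i hi1 hi]
      omega
    exact not_bipSub_five_of_six (bipMinusStar k 6 (k - 7)) ⟨1, by omega⟩ ⟨2, by omega⟩ ⟨3, by omega⟩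
      ⟨4, by omega⟩ ⟨5, by omega⟩ ⟨k - 1, by omega⟩
      (hne 1 2 (by norm_num) (by norm_num) (by norm_num)) (hne 1 3 (by norm_num) (by norm_num) (by norm_num))
      (hne 1 4 (by norm_num) (by norm_num) (by norm_num)) (hne 1 5 (by norm_num) (by norm_num) (by norm_num))
      (hnel 1 (by norm_num))
      (hne 2 3 (by norm_num) (by norm_num) (by norm_num)) (hne 2 4 (by norm_num) (by norm_num) (by norm_num))
      (hne 2 5 (by norm_num) (by norm_num) (by norm_num)) (hnel 2 (by norm_num))
      (hne 3 4 (by norm_num) (by norm_num) (by norm_num)) (hne 3 5 (by norm_num) (by norm_num) (by norm_num))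
      (hnel 3 (by norm_num))
      (hne 4 5 (by norm_num) (by norm_num) (by norm_num)) (hnel 4 (by norm_num))
      (hnel 5 (by norm_num))
      (hd 1 (by norm_num) (by norm_num)) (hd 2 (by norm_num) (by norm_num)) (hd 3 (by norm_num) (by norm_num))
      (hd 4 (by norm_num) (by norm_num)) (hd 5 (by norm_num) (by norm_num))
      (by rw [five_four_witness_deg_last k hk]) A hA hB
  · obtain ⟨S, hSdef⟩ : ∃ S, ∑ v, deg (bipMinusStar k 6 (k - 7)) v * deg (bipMinusStar k 6 (k - 7)) v = S :=
      ⟨_, rfl⟩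
    obtain ⟨E, hEdef⟩ : ∃ E, (bipMinusStar k 6 (k - 7)).edgeFinset.card = E := ⟨_, rfl⟩
    rw [hSdef] at hS
    rw [hEdef] at hE
    rw [hSdef, hEdef]
    obtain ⟨s, rfl⟩ : ∃ s, k = s + 14 := ⟨k - 14, by omega⟩
    have e2 : 2 * (s + 14) - (s + 14 - 7) - 1 = s + 20 := by omega
    have e1 : s + 14 - 7 = s + 7 := by omega
    have e3 : s + 14 - 6 = s + 8 := by omega
    have e4 : s + 14 - 5 = s + 9 := by omega
    have e5 : 2 * (s + 14) - 22 = 2 * s + 6 := by omega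
    rw [e2, e1, e3] at hS
    rw [e1, e3] at hE
    rw [e4, e5]
    have hE' : E = 5 * s + 41 := by omega
    subst hE'
    nlinarith [hS]

/-- **THE NON-BIPARTITE SECOND-BEST VALUE ON `(k, 5, 4)`, `k ≥ 14`:** every non-`5`-bipartite `K₄⁻`-free graph on
`Fin k` with `5 (k − 5) − 4` edges has `Σ_v d(v)² + 4 (k − 5) + (2k − 22) ≤ m k`, and the value is attained by a
non-`5`-bipartite graph (the family `B2`). -/
theorem five_four_nonbip_second_best (k : ℕ) (hk : 14 ≤ k) :
    (∀ (D : SimpleGraph (Fin k)) [DecidableRel D.Adj], K4mFree D → D.edgeFinset.card + 4 = 5 * (k - 5) →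
        (¬ ∃ A : Finset (Fin k), A.card = 5 ∧ BipSub D A) →
        ∑ v, deg D v * deg D v + 4 * (k - 5) + (2 * k - 22) ≤ D.edgeFinset.card * k) ∧
      ∃ (D : SimpleGraph (Fin k)) (_ : DecidableRel D.Adj), K4mFree D ∧ D.edgeFinset.card + 4 = 5 * (k - 5) ∧
        (¬ ∃ A : Finset (Fin k), A.card = 5 ∧ BipSub D A) ∧
        ∑ v, deg D v * deg D v + 4 * (k - 5) + (2 * k - 22) = D.edgeFinset.card * k := by
  have hcard : Fintype.card (Fin k) = k := Fintype.card_fin k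
  refine ⟨?_, ?_⟩
  · intro D _ hK hm hnb
    rcases five_four_second_order_B2 D hK (by omega) (by rw [hcard]; exact hm) with h | h
    · exact absurd h hnb
    · rw [hcard] at h
      exact h
  · obtain ⟨hK, hE, hnb, hS⟩ := five_four_witness k hk
    exact ⟨bipMinusStar k 6 (k - 7), inferInstance, hK, hE, hnb, hS⟩

/-- On `(k, 5, 4)` the table value `tFamilyGap k 5 4` is `2 (k − 11)` — the gap `B2` (not the one-triangle family). -/
theorem tFamilyGap_five_four (k : ℕ) : tFamilyGap k 5 4 = 2 * (k - 11) := by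
  unfold tFamilyGap
  have e : (4 + 2 - 5) * (4 + 1 - 5) = 0 := by norm_num
  omega

/-- On `(k, 5, 3)` the table value `tFamilyGap k 5 3` is `2 (k − 11)` — the gap `T` of part 199g. -/
theorem tFamilyGap_five_three (k : ℕ) : tFamilyGap k 5 3 = 2 * (k - 11) := by
  unfold tFamilyGap
  have e : (3 + 2 - 5) * (3 + 1 - 5) = 0 := by norm_num
  omega

/-- **THE NON-BIPARTITE SECOND-BEST TABLE ON THE ROW `a = 5` AT `r = 3, 4`:** for `14 ≤ k` and `r ∈ {3, 4}`, every
non-`5`-bipartite `K₄⁻`-free graph on `Fin k` with `5 (k − 5) − r` edges has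
`Σ_v d(v)² + r (k − 1 − r) + tFamilyGap k 5 r ≤ m k`, and the value is attained by a non-`5`-bipartite graph
(`r = 3`: the one-triangle family `T`, part 199g; `r = 4`: the family `B2`). -/
theorem nonbip_second_best_row_five_T (k r : ℕ) (hr : r = 3 ∨ r = 4) (hk : 14 ≤ k) :
    (∀ (D : SimpleGraph (Fin k)) [DecidableRel D.Adj], K4mFree D → D.edgeFinset.card + r = 5 * (k - 5) →
        (¬ ∃ A : Finset (Fin k), A.card = 5 ∧ BipSub D A) →
        ∑ v, deg D v * deg D v + r * (k - 1 - r) + tFamilyGap k 5 r ≤ D.edgeFinset.card * k) ∧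
      ∃ (D : SimpleGraph (Fin k)) (_ : DecidableRel D.Adj), K4mFree D ∧ D.edgeFinset.card + r = 5 * (k - 5) ∧
        (¬ ∃ A : Finset (Fin k), A.card = 5 ∧ BipSub D A) ∧
        ∑ v, deg D v * deg D v + r * (k - 1 - r) + tFamilyGap k 5 r = D.edgeFinset.card * k := by
  rcases hr with rfl | rfl
  · rw [tFamilyGap_five_three]
    have e : 3 * (k - 1 - 3) = 3 * (k - 4) := by omega
    have e2 : 2 * (k - 11) = 2 * k - 22 := by omega
    rw [e, e2]
    obtain ⟨h1, D, inst, hK, hE, hnb, hS⟩ := five_three_nonbip_second_best k (by omega)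
    exact ⟨h1, D, inst, hK, hE, fun ⟨A, _, hB⟩ => hnb A hB, hS⟩
  · rw [tFamilyGap_five_four]
    have e : 4 * (k - 1 - 4) = 4 * (k - 5) := by omega
    have e2 : 2 * (k - 11) = 2 * k - 22 := by omega
    rw [e, e2]
    exact five_four_nonbip_second_best k hk

end C047

end TriangleCap

end PercRepro
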